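import Summits.CriticalPhenomena.CardyFormulaZ2.Theorems.CardySelfDualSegmentUniformMarginalitySandwichGlue

/-!
# Pair glue of line `Sketch`: the transport kernel concerns rectilinear domains only
(crux `UniformMarginality`, stmt-CriticalPhenomena-5472)

Skeleton v7 of the lead's line states the transport's kernel as RECTILINEAR PAIR CONTINUITY at a single
parameter: for every conformal rectangle `R`, `t₀ ∈ [0,1]`, `ε > 0` there is `ε₀ > 0` such that any two
RECTILINEAR conformal rectangles `Q₁`, `Q₂`, both `ε₀`-close to `R` in boundary loop and marks, have a
mesh threshold `δ₀(Q₁,Q₂) > 0` with `|P_{t₀}(Q₁,δ) − P_{t₀}(Q₂,δ)| ≤ ε` for `0 < δ < δ₀`. The wild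
boundary of `R` never carries a probability: `R` enters only as the centre of the `ε₀`-ball.

Proved here: `stub_fixedDomainContinuity_of_pair` — rectilinear pair continuity ⟹ the fixed-parameter
domain continuity (B₂a″) of skeleton v6 (`|P_{t₀}(Q,δ) − P_{t₀}(R,δ)| ≤ ε` for `ε₀`-close rectilinear
`Q`): squeeze `R' ≤ R ≤ R''` by the landed geometry `stub_mixedApproximants` (p114647) and
`Pext_mono_of_nested` (p115057), then `P(Q) − P(R) ≤ P(Q) − P(R')` and `P(R) − P(Q) ≤ P(R'') − P(Q)`,
two instances of pair continuity. Consequently (with the landed v6 glue, transport and base-point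
files) the crux for ARBITRARY Jordan rectangles is reduced to two statements about RECTILINEAR domains
only: the crux on rectilinear domains (B₁) and rectilinear pair continuity at each parameter (B₂).
-/

noncomputable section

namespace Summit.CriticalPhenomena.CardyFormulaZ2.Cruxes.UniformMarginality.HeatFlow

open MeasureTheory Literature.Probability.Percolation Literature.Probability.LatticeModels
  Literature.Probability.RandomPlanarGeometry

/-- STUB (glue G₁) of skeleton v7 — **fixed-parameter domain continuity from rectilinear pair
continuity**: if any two rectilinear conformal rectangles `ε₀`-close to `R` have `ε`-close crude
crossing probabilities at `t₀` below a mesh threshold, then every rectilinear `Q` that is `ε₀`-close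
to `R` is `ε`-close to `R` itself at `t₀` below a threshold — by the rectilinear sandwich
`R' ≤ R ≤ R''` of `stub_mixedApproximants` and monotonicity. -/
theorem stub_fixedDomainContinuity_of_pair :
    (∀ (R : ConformalRectangle) (t₀ : ℝ), t₀ ∈ Set.Icc (0 : ℝ) 1 → ∀ ε : ℝ, 0 < ε →
      ∃ ε₀ > 0, ∀ Q₁ Q₂ : ConformalRectangle,
        (∃ S : Finset (ℂ × ℂ), (∀ p ∈ S, p.1.re = p.2.re ∨ p.1.im = p.2.im) ∧
          frontier Q₁.carrier ⊆ ⋃ p ∈ S, segment ℝ p.1 p.2) →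
        (∃ S : Finset (ℂ × ℂ), (∀ p ∈ S, p.1.re = p.2.re ∨ p.1.im = p.2.im) ∧
          frontier Q₂.carrier ⊆ ⋃ p ∈ S, segment ℝ p.1 p.2) →
        (∀ u : ℝ, dist (Q₁.boundary u) (R.boundary u) ≤ ε₀) → (∀ i : Fin 4, |Q₁.mark i - R.mark i| ≤ ε₀) →
        (∀ u : ℝ, dist (Q₂.boundary u) (R.boundary u) ≤ ε₀) → (∀ i : Fin 4, |Q₂.mark i - R.mark i| ≤ ε₀) →
        ∃ δ₀ > 0, ∀ δ : ℝ, 0 < δ → δ < δ₀ → |Pext Q₁ δ t₀ - Pext Q₂ δ t₀| ≤ ε) →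
    (∀ (R : ConformalRectangle) (t₀ : ℝ), t₀ ∈ Set.Icc (0 : ℝ) 1 → ∀ ε : ℝ, 0 < ε →
      ∃ ε₀ > 0, ∀ Q : ConformalRectangle,
        (∃ S : Finset (ℂ × ℂ), (∀ p ∈ S, p.1.re = p.2.re ∨ p.1.im = p.2.im) ∧
          frontier Q.carrier ⊆ ⋃ p ∈ S, segment ℝ p.1 p.2) →
        (∀ u : ℝ, dist (Q.boundary u) (R.boundary u) ≤ ε₀) → (∀ i : Fin 4, |Q.mark i - R.mark i| ≤ ε₀) →
        ∃ δ₀ > 0, ∀ δ : ℝ, 0 < δ → δ < δ₀ → |Pext Q δ t₀ - Pext R δ t₀| ≤ ε) := by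
  intro hpair R t₀ ht₀ ε hε
  obtain ⟨ε₀, hε₀, hP⟩ := hpair R t₀ ht₀ ε hε
  obtain ⟨R', R'', hS', hS'', hb', hm', hb'', hm'', δ₁, hδ₁, hnest⟩ :=
    stub_mixedApproximants R ε₀ hε₀
  refine ⟨ε₀, hε₀, fun Q hSQ hbQ hmQ => ?_⟩
  obtain ⟨δa, hδa, ha⟩ := hP Q R' hSQ hS' hbQ hmQ hb' hm'       -- |P(Q) − P(R')| ≤ ε
  obtain ⟨δb, hδb, hb⟩ := hP R'' Q hS'' hSQ hb'' hm'' hbQ hmQ   -- |P(R'') − P(Q)| ≤ ε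
  refine ⟨min δ₁ (min δa δb), lt_min hδ₁ (lt_min hδa hδb), fun δ hδ hδlt => ?_⟩
  have hδ₁' : δ < δ₁ := hδlt.trans_le (min_le_left _ _)
  have hδa' : δ < δa := hδlt.trans_le ((min_le_right _ _).trans (min_le_left _ _))
  have hδb' : δ < δb := hδlt.trans_le ((min_le_right _ _).trans (min_le_right _ _))
  have hlo : Pext R' δ t₀ ≤ Pext R δ t₀ :=
    Pext_mono_of_nested (fun ω hω hωc => (hnest δ hδ hδ₁' ω hω).1 hωc) t₀
  have hhi : Pext R δ t₀ ≤ Pext R'' δ t₀ :=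
    Pext_mono_of_nested (fun ω hω hωc => (hnest δ hδ hδ₁' ω hω).2 hωc) t₀
  have h1 := ha δ hδ hδa'
  have h2 := hb δ hδ hδb'
  rw [abs_le] at h1 h2 ⊢
  constructor <;> linarith [h1.1, h1.2, h2.1, h2.2]

end Summit.CriticalPhenomena.CardyFormulaZ2.Cruxes.UniformMarginality.HeatFlow

end
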